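import Summits.Ventures.PercRepro.C041TriDomExcessRec

/-!
# ROW C-041 — THEOREM (THE EXCESS IS NON-NEGATIVE): `N_RB + N_WRj + N_RWj ≤ N_RRa` for EVERY finite two-exit host
(p6, gen 41; P6-TWOEXIT-LEAN.md §53)

The bridge from the status framework (`C041TriDomExcessStatus`, `C041TriDomExcessRec`) to the tree's excess count
`excess = N_RRa − N_RB − N_WRj − N_RWj` (`C041TriDomNormalForm`): with every edge free the adjacencies are the host's
(`RAdjS_free`, `BAdjS_free`) and the patterns are read off the status type `styp` (`rsig_free`, `bsig_free`); a type
count `tcount` is an indicator sum (`tcount_eq_sum`), so `excess` is the integer sum `excessZ = Σ_ω FancT (styp ω)`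
(`excess_eq_excessZ`, `FancT_eq`); the complementation `styp_cpl` exchanges the two arguments of `Fanc`
(`sum_Fanc_swap`), so `esym (all free) = 2 • excessZ` (`esym_free_eq`).  With `esym_nonneg` this is
**THEOREM (THE EXCESS IS NON-NEGATIVE)** `excess_nonneg : 0 ≤ excess Z₁ u u′ a₁`, i.e. `tcount_excess_le :
N_RB + N_WRj + N_RWj ≤ N_RRa` — CONJECTURE (THE EXCESS IS NON-NEGATIVE) of §52 is a theorem, and THEOREM (DICHOTOMY)
holds unconditionally (every two-exit block map is whole triangles + bare apart excesses + tree maps).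
-/

namespace PercRepro

namespace ZoneZ

namespace MultiExit

open ZoneData Pendant Finset TwoExit TreeClosure RelaxedTriangle

variable {V₁ E₁ U₁ U₂ : Type} (Z₁ : ZoneData V₁ E₁ U₁ U₂) (u u' a₁ : V₁)

variable [DecidableEq E₁] [Fintype E₁]

/-! ## The bridge to `excess` -/

omit [DecidableEq E₁] [Fintype E₁] in
/-- All edges free: the red adjacency is the host's. -/
theorem RAdjS_free (ω : E₁ → Bool) : RAdjS Z₁ (fun _ => EStat.free) ω = Z₁.RedAdjE ω := by
  funext x y
  simp [RAdjS, ZoneData.RedAdjE, redE]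

omit [DecidableEq E₁] [Fintype E₁] in
/-- All edges free: the blue adjacency is the host's. -/
theorem BAdjS_free (ω : E₁ → Bool) : BAdjS Z₁ (fun _ => EStat.free) ω = Z₁.BlueAdjE ω := by
  funext x y
  simp [BAdjS, ZoneData.BlueAdjE, blueE]

/-- The anchored excess functional on a status type. -/
def FancT (t : Typ) : ℤ :=
  (if t = (false, true, false, true, false, true) then 1 else 0)
    - (if t = (false, true, true, false, false, false) then 1 else 0)
    - (if t = (false, false, false, true, true, false) then 1 else 0)
    - (if t = (false, true, false, false, true, false) then 1 else 0)

/-- `FancT` is `Fanc` at the red and blue coordinates of the type. -/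
theorem FancT_eq (t : Typ) :
    FancT t = Fanc (t.2.1, t.2.2.2.1, t.2.2.2.2.2) (t.1, t.2.2.1, t.2.2.2.2.1) := by
  revert t; decide

omit [DecidableEq E₁] [Fintype E₁] in
/-- All edges free: red connectivity is the host's. -/
theorem RdS_free (ω : E₁ → Bool) (k v : V₁) : RdS Z₁ (fun _ => EStat.free) ω k v ↔ Z₁.Rd k v ω := by
  rw [RdS, ZoneData.Rd, RAdjS_free]

omit [DecidableEq E₁] [Fintype E₁] in
/-- All edges free: blue connectivity is the host's. -/
theorem MgS_free (ω : E₁ → Bool) (k v : V₁) : MgS Z₁ (fun _ => EStat.free) ω k v ↔ Z₁.Mg k v ω := by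
  rw [MgS, ZoneData.Mg, BAdjS_free]

omit [DecidableEq E₁] [Fintype E₁] in
/-- All edges free: the red pattern is read off the status type. -/
theorem rsig_free (ω : E₁ → Bool) :
    rsig Z₁ u u' a₁ (fun _ => EStat.free) ω =
      ((styp Z₁ u u' a₁ ω).2.1, (styp Z₁ u u' a₁ ω).2.2.2.1, (styp Z₁ u u' a₁ ω).2.2.2.2.2) := by
  simp only [rsig, styp, Prod.mk.injEq, decide_eq_decide]
  exact ⟨RdS_free Z₁ ω a₁ u, RdS_free Z₁ ω a₁ u', RdS_free Z₁ ω u u'⟩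

omit [DecidableEq E₁] [Fintype E₁] in
/-- All edges free: the blue pattern is read off the status type. -/
theorem bsig_free (ω : E₁ → Bool) :
    bsig Z₁ u u' a₁ (fun _ => EStat.free) ω =
      ((styp Z₁ u u' a₁ ω).1, (styp Z₁ u u' a₁ ω).2.2.1, (styp Z₁ u u' a₁ ω).2.2.2.2.1) := by
  simp only [bsig, styp, Prod.mk.injEq, decide_eq_decide]
  exact ⟨MgS_free Z₁ ω a₁ u, MgS_free Z₁ ω a₁ u', MgS_free Z₁ ω u u'⟩

open Classical in
/-- The excess as an integer sum over the colourings. -/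
noncomputable def excessZ : ℤ := ∑ ω : E₁ → Bool, FancT (styp Z₁ u u' a₁ ω)

open Classical in
/-- A type count is an indicator sum. -/
theorem tcount_eq_sum (t : Typ) :
    tcount Z₁ u u' a₁ t = ∑ ω : E₁ → Bool, if styp Z₁ u u' a₁ ω = t then 1 else 0 := by
  unfold tcount
  rw [Finset.card_filter]

open Classical in
/-- The tree's `excess` is the integer sum `excessZ`. -/
theorem excess_eq_excessZ : excess Z₁ u u' a₁ = (excessZ Z₁ u u' a₁ : ℝ) := by
  unfold excess excessZ
  simp only [tcount_eq_sum, Nat.cast_sum, Nat.cast_ite, Nat.cast_one, Nat.cast_zero, Int.cast_sum,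
    ← Finset.sum_sub_distrib]
  refine Finset.sum_congr rfl fun ω _ => ?_
  simp only [FancT]
  push_cast
  rfl

open Classical in
/-- The complementation exchanges the two arguments of `Fanc`: the swapped sum is the same sum. -/
theorem sum_Fanc_swap :
    ∑ ω : E₁ → Bool, Fanc (bsig Z₁ u u' a₁ (fun _ => EStat.free) ω) (rsig Z₁ u u' a₁ (fun _ => EStat.free) ω) =
      ∑ ω : E₁ → Bool, Fanc (rsig Z₁ u u' a₁ (fun _ => EStat.free) ω) (bsig Z₁ u u' a₁ (fun _ => EStat.free) ω) := by
  have hinv : Function.Involutive (ZoneData.cpl (E := E₁)) := ZoneData.cpl_cpl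
  rw [← Equiv.sum_comp hinv.toPerm]
  refine Finset.sum_congr rfl fun ω _ => ?_
  simp only [Function.Involutive.coe_toPerm]
  rw [rsig_free Z₁ u u' a₁, bsig_free Z₁ u u' a₁, rsig_free Z₁ u u' a₁, bsig_free Z₁ u u' a₁, styp_cpl]
  rfl

open Classical in
/-- The symmetrised excess of the all-free status is twice the excess. -/
theorem esym_free_eq : esym Z₁ u u' a₁ (fun _ => EStat.free) = 2 * excessZ Z₁ u u' a₁ := by
  unfold esym excessZ
  simp only [Fsym, Finset.sum_add_distrib, sum_Fanc_swap Z₁ u u' a₁]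
  rw [two_mul]
  congr 1 <;> exact Finset.sum_congr rfl fun ω _ => by rw [FancT_eq, rsig_free Z₁, bsig_free Z₁]

/-- **THEOREM (THE EXCESS IS NON-NEGATIVE)**: `N_RB + N_WRj + N_RWj ≤ N_RRa` for every finite two-exit host. -/
theorem excess_nonneg : 0 ≤ excess Z₁ u u' a₁ := by
  rw [excess_eq_excessZ Z₁ u u' a₁]
  have h := esym_nonneg Z₁ u u' a₁ (fun _ => EStat.free)
  rw [esym_free_eq Z₁ u u' a₁] at h
  have : (0 : ℤ) ≤ excessZ Z₁ u u' a₁ := by linarith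
  exact_mod_cast this

/-- The excess inequality in the form of the conjecture: `N_RB + N_WRj + N_RWj ≤ N_RRa`. -/
theorem tcount_excess_le :
    tcount Z₁ u u' a₁ (false, true, true, false, false, false)
        + tcount Z₁ u u' a₁ (false, false, false, true, true, false)
        + tcount Z₁ u u' a₁ (false, true, false, false, true, false) ≤
      tcount Z₁ u u' a₁ (false, true, false, true, false, true) := by
  have h := excess_nonneg Z₁ u u' a₁
  unfold excess at h
  exact_mod_cast (by linarith : ((tcount Z₁ u u' a₁ (false, true, true, false, false, false) : ℝ)
    + tcount Z₁ u u' a₁ (false, false, false, true, true, false)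
    + tcount Z₁ u u' a₁ (false, true, false, false, true, false) ≤
      tcount Z₁ u u' a₁ (false, true, false, true, false, true)))

/-! ## THEOREM (DICHOTOMY), unconditional -/

/-- The excess count as a natural number (exact by `tcount_excess_le`). -/
noncomputable def excessN : ℕ :=
  tcount Z₁ u u' a₁ (false, true, false, true, false, true)
    - (tcount Z₁ u u' a₁ (false, true, true, false, false, false)
      + tcount Z₁ u u' a₁ (false, false, false, true, true, false)
      + tcount Z₁ u u' a₁ (false, true, false, false, true, false))

/-- The number of whole triangles a two-exit host contains: `min (e, N_RRj, N_BX, N_XB)`. -/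
noncomputable def triCount : ℕ :=
  min (excessN Z₁ u u' a₁)
    (min (tcount Z₁ u u' a₁ (false, true, false, true, true, true))
      (min (tcount Z₁ u u' a₁ (true, false, true, true, true, false))
        (tcount Z₁ u u' a₁ (true, true, true, false, true, false))))

/-- **THEOREM (DICHOTOMY), UNCONDITIONAL**: EVERY two-exit block map is `triCount` whole triangles, `e − triCount`
bare apart excesses and manifest cone (tree) maps — THEOREM (DICHOTOMY) of `C041TriDomNormalForm` with the
hypothesis `e ≥ 0` discharged by `excess_nonneg` and `c = min (e, N_RRj, N_BX, N_XB)`. -/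
theorem blockMap_ex2_eq_dichotomy_all (w w' : Vec6) :
    blockMap Z₁ (ex2 u u') a₁ (fun b => if b then w' else w) =
      (triCount Z₁ u u' a₁ : ℝ) • thetaTri w w'
        + ((excessN Z₁ u u' a₁ - triCount Z₁ u u' a₁ : ℕ) : ℝ) • apartExcess w w'
        + ((tcount Z₁ u u' a₁ (false, true, false, true, true, true) - triCount Z₁ u u' a₁ : ℕ) : ℝ) • ellv (w * w')
        + (tcount Z₁ u u' a₁ (false, true, true, false, false, false) : ℝ) • (ellv w * ellv w')
        + (tcount Z₁ u u' a₁ (false, false, false, true, true, false) : ℝ) • ellv (ellv w * w')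
        + (tcount Z₁ u u' a₁ (false, true, false, false, true, false) : ℝ) • ellv (w * ellv w')
        + ((tcount Z₁ u u' a₁ (true, false, true, true, true, false) - triCount Z₁ u u' a₁ : ℕ) : ℝ) • (ellv w * w')
        + ((tcount Z₁ u u' a₁ (true, true, true, false, true, false) - triCount Z₁ u u' a₁ : ℕ) : ℝ) • (w * ellv w')
        + (tcount Z₁ u u' a₁ (true, true, true, true, true, true) : ℝ) • (w * w')
        + (tcount Z₁ u u' a₁ (false, false, false, true, false, false) : ℝ) • (nAdm w • ellv w')
        + (tcount Z₁ u u' a₁ (false, true, false, false, false, false) : ℝ) • (nAdm w' • ellv w)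
        + (tcount Z₁ u u' a₁ (false, false, true, true, false, false) : ℝ) • (nAdm w • w')
        + (tcount Z₁ u u' a₁ (true, true, false, false, false, false) : ℝ) • (nAdm w' • w)
        + ((tcount Z₁ u u' a₁ (false, false, false, false, true, true) : ℝ)
            + tcount Z₁ u u' a₁ (false, false, false, false, true, false)) • (nAdm (w * w') • (1 : Vec6))
        + ((tcount Z₁ u u' a₁ (false, false, false, false, true, false) : ℝ)
            + tcount Z₁ u u' a₁ (false, false, false, false, false, false)) • ((nAdm w * nAdm w') • (1 : Vec6)) := by
  have hle := tcount_excess_le Z₁ u u' a₁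
  have hc1 : triCount Z₁ u u' a₁ ≤ excessN Z₁ u u' a₁ := Nat.min_le_left _ _
  have hc2 : triCount Z₁ u u' a₁ ≤ tcount Z₁ u u' a₁ (false, true, false, true, true, true) :=
    (Nat.min_le_right _ _).trans (Nat.min_le_left _ _)
  have hc3 : triCount Z₁ u u' a₁ ≤ tcount Z₁ u u' a₁ (true, false, true, true, true, false) :=
    (Nat.min_le_right _ _).trans ((Nat.min_le_right _ _).trans (Nat.min_le_left _ _))
  have hc4 : triCount Z₁ u u' a₁ ≤ tcount Z₁ u u' a₁ (true, true, true, false, true, false) :=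
    (Nat.min_le_right _ _).trans ((Nat.min_le_right _ _).trans (Nat.min_le_right _ _))
  refine blockMap_ex2_eq_dichotomy Z₁ u u' a₁ (triCount Z₁ u u' a₁) (excessN Z₁ u u' a₁ - triCount Z₁ u u' a₁)
    (tcount Z₁ u u' a₁ (false, true, false, true, true, true) - triCount Z₁ u u' a₁)
    (tcount Z₁ u u' a₁ (true, false, true, true, true, false) - triCount Z₁ u u' a₁)
    (tcount Z₁ u u' a₁ (true, true, true, false, true, false) - triCount Z₁ u u' a₁) ?_ ?_ ?_ ?_ w w'
  · unfold excessN at hc1 ⊢; omega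
  · omega
  · omega
  · omega

end MultiExit

end ZoneZ

end PercRepro
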